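import Mathlib
import Literature.Algebra.Polynomial.JacobianCriterion
import HarnessLib

/-!
# Definability gap — a Mason–Stothers instrument for three coprime products of homogeneous primes

Helper-lane INSTRUMENT file for OFFER O-L5-MASON (decomp-val-lens-5 g39) on the `KIPlantedHittingRO` helper lane
(`stmt-ValiantsHypothesis-23704`): abstract commutative algebra over a field `K` (characteristic `0` in § 2), with NO
data definitions and NO problem-specific objects. It proves NOTHING about the summit, closes NO item, earns
0 S-currency, and is NOT claimed to bear on `KIPlantedHitting` (K1); it is the algebraic half of the graphical
ΣΠΣ(3) theorem of the companion file `DefinabilityGapGraphicalThree`, which instantiates `q_e := P_u − P_v` (the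
Kabanets–Impagliazzo seed polynomials of two distinct blocks).

## Contents

* § 1 COLLAPSE (any field). The FACTOR THEOREM under a relabel-collapse `v ↦ u` of the variables:
  `rename (v ↦ u) f = 0 ⟹ (X v − X u) ∣ f` (`X_sub_X_dvd_of_rename_eq_zero`): transport `f` to `K[z][T]` by the
  lift `z_v ↦ T` (`eval_X_aeval_lift`: evaluating the lift at `T := z_w` is the relabelling `v ↦ w`) and apply
  `Polynomial.sub_dvd_eval_sub`. The DIVISOR COUNT (`card_le_totalDegree_of_rename_eq_zero`): loopless, pairwise
  non-reversed pairs `(u, v)` whose collapses all annihilate one `f ≠ 0` number at most `deg f` — the linear forms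
  `X v − X u` are pairwise non-associated, and each one found as a factor costs one degree.
* § 2 MASON–STOTHERS FOR THREE TERMS (characteristic `0`). For pairwise label-disjoint multisets `E₁ E₂ E₃` of one
  size `n > 0` over a family `q` of pairwise non-associated primes (`q i ∣ q j ⟹ i = j`), all homogeneous of one
  degree `d > 0`, a vanishing combination `α₁ Πq(E₁) + α₂ Πq(E₂) + α₃ Πq(E₃) = 0` with `α₁ α₂ α₃ ≠ 0` forces
  `d·n < d·N`, `N :=` the number of distinct labels (`masonStothers_three`). Proof = the WRONSKIAN CERTIFICATE with
  ONE partial derivative `∂_s`, chosen with `∂_s Πq(E₁) ≠ 0` (`eq_C_of_forall_pderiv_eq_zero`, characteristic `0`):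
  `W := A₁ ∂_s A₂ − A₂ ∂_s A₁ ≠ 0` because `W = 0` would give `A₁ ∣ A₂ ∂_s A₁`, hence `A₁ ∣ ∂_s A₁` by cross-term
  coprimality (`prod_dvd_of_dvd_mul`), against `deg ∂_s A₁ < deg A₁` (`totalDegree_pderiv_lt`); the relation gives
  `α₂ W = −α₃ (A₁ ∂_s A₃ − A₃ ∂_s A₁)`; a label `j` of multiplicity `c_j` yields `q_j^(c_j − 1) ∣ W`
  (`pow_pred_dvd_pderiv`); pairwise non-associated prime powers multiply up (`prod_pow_dvd_of_forall_dvd`); and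
  degrees finish: `Σ_j d (c_j − 1) = d (3n − N) ≤ deg W < 2dn`.

HONEST BOUNDARY: pure commutative-algebra instrument (multivariate factor theorem under a relabel-collapse, divisor
count, derivative and product lemmas, three-term Mason–Stothers for products of pairwise non-associated homogeneous
primes of one degree); no programme statement, no generator, no circuit class; 0 S-currency; closes NO item. Three
terms only: for `k ≥ 4` terms the classical generalisation of this certificate (generalised Wronskians) bounds `n`
by a MULTIPLE of `N` and gives no contradiction with `N ≤ n`; nothing of the kind is claimed or attempted here.
Nothing in this file is specific to the Kabanets–Impagliazzo generator.

ELEMENTARY · NEW-COMBINATION (the Mason–Stothers / polynomial-`abc` move — Stothers 1981, Mason 1984; in identity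
testing for sums of few products of linear forms, Saxena–Seshadhri 2013 — combined with the relabel-collapse factor
theorem; the ingredients are classical, the use on this road is new) · 0 S-currency · closes NO item · cyclic and
forest supports alike are untouched HERE (this file has no graphs). Citations in prose only: Kabanets–Impagliazzo 2003
and Nisan–Wigderson 1994 (the lane); Stothers 1981, Mason 1984, Saxena–Seshadhri 2013 (the certificate).
-/

open MvPolynomial
open Literature.Algebra.Polynomial.JacobianCriterion

set_option linter.dupNamespace false

namespace Summit.ValiantsHypothesis.ValiantsHypothesis.Theorems.DefinabilityGapMasonStothers

/-! ## 1. Collapse: the factor theorem under `v ↦ u` and the divisor count -/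

section Collapse

variable {σ : Type*} [DecidableEq σ] {K : Type*} [Field K]

/-- AUX (transport). The lift `z_v ↦ T`, `z_c ↦ z_c` into `K[z][T]`, evaluated at `T := z_w`, is the relabelling
`v ↦ w` (two `K`-algebra maps agreeing on the variables). [this file] -/
theorem eval_X_aeval_lift (v w : σ) (g : MvPolynomial σ K) :
    Polynomial.eval (X w : MvPolynomial σ K)
        (aeval (fun c => if c = v then Polynomial.X else Polynomial.C (X c : MvPolynomial σ K)) g) =
      rename (fun c => if c = v then w else c) g := by
  have e : ((Polynomial.aeval (X w : MvPolynomial σ K) :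
        Polynomial (MvPolynomial σ K) →ₐ[MvPolynomial σ K] MvPolynomial σ K).restrictScalars K).comp
          (aeval fun c => if c = v then Polynomial.X else Polynomial.C (X c : MvPolynomial σ K)) =
        rename fun c => if c = v then w else c := by
    refine MvPolynomial.algHom_ext fun c => ?_
    rw [AlgHom.comp_apply, AlgHom.restrictScalars_apply, aeval_X, rename_X]
    by_cases hc : c = v
    · rw [if_pos hc, if_pos hc, Polynomial.aeval_X]
    · rw [if_neg hc, if_neg hc, Polynomial.aeval_C, Algebra.algebraMap_self_apply]
  have e' := AlgHom.congr_fun e g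
  rw [AlgHom.comp_apply, AlgHom.restrictScalars_apply, Polynomial.coe_aeval_eq_eval] at e'
  exact e'

/-- D1 FACTOR THEOREM under the relabel-collapse `v ↦ u`: `ρ_{v→u} f = 0 ⟹ (X v − X u) ∣ f`
(`Polynomial.sub_dvd_eval_sub` in `K[z][T]` between `T := z_v` and `T := z_u`). [this file] -/
theorem X_sub_X_dvd_of_rename_eq_zero (u v : σ) (f : MvPolynomial σ K)
    (h : rename (fun c => if c = v then u else c) f = 0) : X v - X u ∣ f := by
  have hid : rename (fun c => if c = v then v else c) f = f := by
    have e : (fun c => if c = v then v else c) = id := by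
      funext c
      show (if c = v then v else c) = c
      split_ifs with hc
      · exact hc.symm
      · rfl
    rw [e, rename_id_apply]
  have hd := Polynomial.sub_dvd_eval_sub (X v : MvPolynomial σ K) (X u)
    (aeval (fun c => if c = v then Polynomial.X else Polynomial.C (X c : MvPolynomial σ K)) f)
  rwa [eval_X_aeval_lift, eval_X_aeval_lift, hid, h, sub_zero] at hd

/-- D2 DIVISOR COUNT: pairwise non-reversed loopless pairs all collapsing `f ≠ 0` to `0` number `≤ deg f` (peel one
factor `X v − X u` per pair; the collapse of another admissible pair does not kill that factor). [this file] -/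
theorem card_le_totalDegree_of_rename_eq_zero (P : Finset (σ × σ)) {f : MvPolynomial σ K} (hf : f ≠ 0)
    (hP : ∀ e ∈ P, e.1 ≠ e.2) (hP' : ∀ e ∈ P, ∀ e' ∈ P, e ≠ e' → e ≠ e'.swap)
    (h0 : ∀ e ∈ P, rename (fun c => if c = e.2 then e.1 else c) f = 0) : P.card ≤ f.totalDegree := by
  induction P using Finset.induction_on generalizing f with
  | empty => rw [Finset.card_empty]; exact Nat.zero_le _
  | insert e P heP ih =>
    have heI : e ∈ insert e P := Finset.mem_insert_self e P
    have hsub : ∀ e' ∈ P, e' ∈ insert e P := fun e' he' => Finset.mem_insert_of_mem he'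
    obtain ⟨g, hg⟩ := X_sub_X_dvd_of_rename_eq_zero e.1 e.2 f (h0 e heI)
    have hℓ : (X e.2 - X e.1 : MvPolynomial σ K) ≠ 0 :=
      sub_ne_zero.2 fun h => hP e heI (X_injective h).symm
    have hg0 : g ≠ 0 := by
      rintro rfl
      exact hf (by rw [hg, mul_zero])
    have hdeg : f.totalDegree = g.totalDegree + 1 := by
      rw [hg, totalDegree_mul_of_isDomain hℓ hg0,
        ((isHomogeneous_X K e.2).sub (isHomogeneous_X K e.1)).totalDegree hℓ, add_comm]
    rw [Finset.card_insert_of_notMem heP, hdeg, Nat.add_le_add_iff_right]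
    refine ih hg0 (fun e' he' => hP e' (hsub e' he'))
      (fun e' he' e'' he'' => hP' e' (hsub e' he') e'' (hsub e'' he'')) fun e' he' => ?_
    have h1 := h0 e' (hsub e' he')
    rw [hg, map_mul, map_sub, rename_X, rename_X] at h1
    refine (mul_eq_zero.1 h1).resolve_left (sub_ne_zero.2 fun h => ?_)
    have h' := X_injective h
    have hne : e ≠ e' := fun h'' => heP (h'' ▸ he')
    by_cases h2 : e.2 = e'.2
    · rw [if_pos h2, if_neg (fun h3 : e.1 = e'.2 => hP e heI (h3.trans h2.symm))] at h'
      exact hne (Prod.ext h'.symm h2)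
    · rw [if_neg h2] at h'
      by_cases h3 : e.1 = e'.2
      · rw [if_pos h3] at h'
        exact hP' e heI e' (hsub e' he') hne (Prod.ext h3 h')
      · rw [if_neg h3] at h'
        exact hP e heI h'.symm

end Collapse

/-! ## 2. Mason–Stothers for three coprime terms -/

section Mason

variable {ι : Type*} [DecidableEq ι] {σ : Type*} {K : Type*} [Field K]

/-- DERIVATIVE LEMMA: `q^k ∣ A ⟹ q^(k-1) ∣ ∂_s A` (Leibniz). [this file] -/
theorem pow_pred_dvd_pderiv {q A : MvPolynomial σ K} {k : ℕ} (s : σ) (h : q ^ k ∣ A) :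
    q ^ (k - 1) ∣ pderiv s A := by
  obtain ⟨B, rfl⟩ := h
  rw [pderiv_mul, pderiv_pow]
  exact dvd_add (Dvd.intro ((k : MvPolynomial σ K) * pderiv s q * B) (by ring))
    (dvd_mul_of_dvd_left (pow_dvd_pow q (Nat.sub_le k 1)) _)

/-- PRODUCT LEMMA: pairwise non-associated prime powers each dividing `W` ⟹ their product divides `W`. [this file] -/
theorem prod_pow_dvd_of_forall_dvd (T : Finset ι) (q : ι → MvPolynomial σ K) (k : ι → ℕ)
    (hprime : ∀ i ∈ T, Prime (q i)) (hrig : ∀ i ∈ T, ∀ j ∈ T, q i ∣ q j → i = j)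
    {W : MvPolynomial σ K} (h : ∀ i ∈ T, q i ^ k i ∣ W) : (∏ i ∈ T, q i ^ k i) ∣ W := by
  induction T using Finset.induction_on generalizing W with
  | empty => rw [Finset.prod_empty]; exact one_dvd W
  | insert a T haT ih =>
    rw [Finset.prod_insert haT]
    obtain ⟨W', rfl⟩ := h a (Finset.mem_insert_self a T)
    refine mul_dvd_mul_left _ (ih (fun i hi => hprime i (Finset.mem_insert_of_mem hi))
      (fun i hi j hj => hrig i (Finset.mem_insert_of_mem hi) j (Finset.mem_insert_of_mem hj))
      fun i hi => ?_)
    have hi' : i ∈ insert a T := Finset.mem_insert_of_mem hi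
    have hia : ¬ q i ∣ q a := fun hd => haT (hrig i hi' a (Finset.mem_insert_self a T) hd ▸ hi)
    exact (hprime i hi').pow_dvd_of_dvd_mul_left (k i)
      (fun hd => hia ((hprime i hi').dvd_of_dvd_pow hd)) (h i hi')

/-- AUX: the full power `q j ^ (count j E)` divides `Πq(E)`. [this file] -/
theorem pow_count_dvd_prod (q : ι → MvPolynomial σ K) (E : Multiset ι) (j : ι) :
    q j ^ Multiset.count j E ∣ (E.map q).prod := by
  by_cases hj : j ∈ E
  · rw [Finset.prod_multiset_map_count E q]
    exact Finset.dvd_prod_of_mem (fun i => q i ^ Multiset.count i E) (Multiset.mem_toFinset.2 hj)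
  · rw [Multiset.count_eq_zero.2 hj, pow_zero]
    exact one_dvd _

omit [DecidableEq ι] in
/-- AUX: a prime `q i` with `i ∉ E` does not divide `Πq(E)` (rigidity `q i ∣ q j ⟹ i = j`). [this file] -/
theorem not_dvd_prod_of_notMem (q : ι → MvPolynomial σ K) {E : Multiset ι} {i : ι} (hi : Prime (q i))
    (hrig : ∀ j ∈ E, q i ∣ q j → i = j) (hiE : i ∉ E) : ¬ q i ∣ (E.map q).prod := by
  intro h
  obtain ⟨a, ha, hd⟩ := hi.exists_mem_multiset_dvd h
  obtain ⟨j, hj, rfl⟩ := Multiset.mem_map.1 ha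
  exact hiE (hrig j hj hd ▸ hj)

/-- AUX (coprime transfer): `Πq(E) ∣ Πq(E')·W` with `E, E'` label-disjoint ⟹ `Πq(E) ∣ W`. [this file] -/
theorem prod_dvd_of_dvd_mul (q : ι → MvPolynomial σ K) {E E' : Multiset ι}
    (hprime : ∀ i ∈ E, Prime (q i)) (hrig : ∀ i ∈ E, ∀ j ∈ E, q i ∣ q j → i = j)
    (hrig' : ∀ i ∈ E, ∀ j ∈ E', q i ∣ q j → i = j) (hdis : ∀ i ∈ E, i ∉ E')
    {W : MvPolynomial σ K} (h : (E.map q).prod ∣ (E'.map q).prod * W) : (E.map q).prod ∣ W := by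
  rw [Finset.prod_multiset_map_count E q]
  refine prod_pow_dvd_of_forall_dvd E.toFinset q (fun i => Multiset.count i E)
    (fun i hi => hprime i (Multiset.mem_toFinset.1 hi))
    (fun i hi j hj => hrig i (Multiset.mem_toFinset.1 hi) j (Multiset.mem_toFinset.1 hj)) fun i hi => ?_
  have hi' := Multiset.mem_toFinset.1 hi
  exact (hprime i hi').pow_dvd_of_dvd_mul_left _
    (not_dvd_prod_of_notMem q (hprime i hi') (hrig' i hi') (hdis i hi')) ((pow_count_dvd_prod q E i).trans h)

/-- AUX (degrees): `deg (A · ∂_s B) < deg A + deg B` once `deg B > 0`. [this file] -/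
theorem totalDegree_mul_pderiv_lt (s : σ) (A B : MvPolynomial σ K) (hB : 0 < B.totalDegree) :
    (A * pderiv s B).totalDegree < A.totalDegree + B.totalDegree := by
  by_cases h : pderiv s B = 0
  · rw [h, mul_zero, totalDegree_zero]; omega
  · have := totalDegree_pderiv_lt h
    exact (totalDegree_mul A (pderiv s B)).trans_lt (by omega)

variable [CharZero K]

/-- (M) MASON–STOTHERS for three coprime terms of pairwise non-associated homogeneous primes: a vanishing combination
`α₁ Πq(E₁) + α₂ Πq(E₂) + α₃ Πq(E₃) = 0` (`αᵢ ≠ 0`, `|Eᵢ| = n > 0`, `E₁ E₂ E₃` pairwise label-disjoint, every `q i`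
homogeneous of degree `d > 0`) forces `d·n < d·N`, `N` = the number of distinct labels — the one-derivative Wronskian
certificate described in the module docstring. [this file] -/
theorem masonStothers_three (q : ι → MvPolynomial σ K) {d n : ℕ} (hd : 0 < d) (hn : 0 < n)
    (E₁ E₂ E₃ : Multiset ι)
    (hprime : ∀ i ∈ E₁ + E₂ + E₃, Prime (q i)) (hhom : ∀ i ∈ E₁ + E₂ + E₃, (q i).IsHomogeneous d)
    (hrig : ∀ i ∈ E₁ + E₂ + E₃, ∀ j ∈ E₁ + E₂ + E₃, q i ∣ q j → i = j)
    (h₁₂ : ∀ i ∈ E₁, i ∉ E₂) (h₁₃ : ∀ i ∈ E₁, i ∉ E₃) (h₂₃ : ∀ i ∈ E₂, i ∉ E₃)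
    (c₁ : Multiset.card E₁ = n) (c₂ : Multiset.card E₂ = n) (c₃ : Multiset.card E₃ = n)
    {α₁ α₂ α₃ : K} (hα₁ : α₁ ≠ 0) (hα₂ : α₂ ≠ 0) (hα₃ : α₃ ≠ 0)
    (hsum : C α₁ * (E₁.map q).prod + C α₂ * (E₂.map q).prod + C α₃ * (E₃.map q).prod = 0) :
    d * n < d * (E₁ + E₂ + E₃).toFinset.card := by
  -- the statement is symmetric in the three terms; the certificate below differentiates against `A₁` and inverts
  -- `α₂` only, so `α₁ ≠ 0`, `α₃ ≠ 0` are recorded here and not used further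
  have _hsym : α₁ ≠ 0 ∧ α₃ ≠ 0 := ⟨hα₁, hα₃⟩
  -- memberships in `S := E₁ + E₂ + E₃`
  have hS₁ : ∀ i ∈ E₁, i ∈ E₁ + E₂ + E₃ := fun i hi =>
    Multiset.mem_add.2 (Or.inl (Multiset.mem_add.2 (Or.inl hi)))
  have hS₂ : ∀ i ∈ E₂, i ∈ E₁ + E₂ + E₃ := fun i hi =>
    Multiset.mem_add.2 (Or.inl (Multiset.mem_add.2 (Or.inr hi)))
  have hS₃ : ∀ i ∈ E₃, i ∈ E₁ + E₂ + E₃ := fun i hi => Multiset.mem_add.2 (Or.inr hi)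
  -- the three products are nonzero and homogeneous of degree `d·n`
  have hne : ∀ E : Multiset ι, (∀ i ∈ E, i ∈ E₁ + E₂ + E₃) → (E.map q).prod ≠ 0 := fun E hE =>
    Multiset.prod_ne_zero fun h0 => by
      obtain ⟨i, hi, hq⟩ := Multiset.mem_map.1 h0
      exact (hprime i (hE i hi)).ne_zero hq
  have hhomE : ∀ E : Multiset ι, (∀ i ∈ E, i ∈ E₁ + E₂ + E₃) →
      ((E.map q).prod).IsHomogeneous (d * Multiset.card E) := by
    intro E hE
    induction E using Multiset.induction_on with
    | empty =>
      rw [Multiset.map_zero, Multiset.prod_zero, Multiset.card_zero, mul_zero]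
      exact isHomogeneous_one σ K
    | cons a E ih =>
      have h := (hhom a (hE a (Multiset.mem_cons_self a E))).mul
        (ih fun i hi => hE i (Multiset.mem_cons_of_mem hi))
      rw [Multiset.map_cons, Multiset.prod_cons, Multiset.card_cons]
      convert h using 1
      ring
  have hdegE : ∀ E : Multiset ι, (∀ i ∈ E, i ∈ E₁ + E₂ + E₃) → Multiset.card E = n →
      ((E.map q).prod).totalDegree = d * n := fun E hE hc => by
    rw [(hhomE E hE).totalDegree (hne E hE), hc]
  -- a direction `s` in which `A₁` is not constant (characteristic `0`)
  obtain ⟨s, hs⟩ : ∃ s, pderiv s (E₁.map q).prod ≠ 0 := by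
    by_contra hcon
    push Not at hcon
    have h := congrArg totalDegree (eq_C_of_forall_pderiv_eq_zero hcon)
    rw [hdegE E₁ hS₁ c₁, totalDegree_C] at h
    exact (mul_pos hd hn).ne' h
  -- the Wronskian `W := A₁ ∂A₂ − A₂ ∂A₁` is nonzero (cross-term coprimality)
  have hW : (E₁.map q).prod * pderiv s (E₂.map q).prod - (E₂.map q).prod * pderiv s (E₁.map q).prod ≠ 0 := by
    intro hW
    have hdvd : (E₁.map q).prod ∣ (E₂.map q).prod * pderiv s (E₁.map q).prod :=
      Dvd.intro _ (sub_eq_zero.1 hW)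
    have hdvd' := prod_dvd_of_dvd_mul q (fun i hi => hprime i (hS₁ i hi))
      (fun i hi j hj => hrig i (hS₁ i hi) j (hS₁ j hj)) (fun i hi j hj => hrig i (hS₁ i hi) j (hS₂ j hj))
      h₁₂ hdvd
    have h1 := totalDegree_le_of_dvd_of_isDomain hdvd' hs
    have h2 := totalDegree_pderiv_lt hs
    omega
  -- every label `j` of multiplicity `c_j` gives `q j ^ (c_j − 1) ∣ W`
  have hDW : (∏ j ∈ (E₁ + E₂ + E₃).toFinset, q j ^ (Multiset.count j (E₁ + E₂ + E₃) - 1)) ∣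
      ((E₁.map q).prod * pderiv s (E₂.map q).prod - (E₂.map q).prod * pderiv s (E₁.map q).prod) := by
    refine prod_pow_dvd_of_forall_dvd _ q _ (fun j hj => hprime j (Multiset.mem_toFinset.1 hj))
      (fun i hi j hj => hrig i (Multiset.mem_toFinset.1 hi) j (Multiset.mem_toFinset.1 hj)) fun j hj => ?_
    have hjS := Multiset.mem_toFinset.1 hj
    have e12 := Multiset.count_add j (E₁ + E₂) E₃
    have e1 := Multiset.count_add j E₁ E₂
    rcases Multiset.mem_add.1 hjS with hj12 | hj3
    · rcases Multiset.mem_add.1 hj12 with hj1 | hj2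
      · -- `j ∈ E₁`
        have z2 := Multiset.count_eq_zero.2 (h₁₂ j hj1)
        have z3 := Multiset.count_eq_zero.2 (h₁₃ j hj1)
        have hc : Multiset.count j (E₁ + E₂ + E₃) = Multiset.count j E₁ := by omega
        rw [hc]
        exact dvd_sub (((pow_dvd_pow _ (Nat.sub_le _ 1)).trans (pow_count_dvd_prod q E₁ j)).mul_right _)
          ((pow_pred_dvd_pderiv s (pow_count_dvd_prod q E₁ j)).mul_left _)
      · -- `j ∈ E₂`
        have z1 := Multiset.count_eq_zero.2 (fun h : j ∈ E₁ => h₁₂ j h hj2)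
        have z3 := Multiset.count_eq_zero.2 (h₂₃ j hj2)
        have hc : Multiset.count j (E₁ + E₂ + E₃) = Multiset.count j E₂ := by omega
        rw [hc]
        exact dvd_sub ((pow_pred_dvd_pderiv s (pow_count_dvd_prod q E₂ j)).mul_left _)
          (((pow_dvd_pow _ (Nat.sub_le _ 1)).trans (pow_count_dvd_prod q E₂ j)).mul_right _)
    · -- `j ∈ E₃`: the relation turns `W` into the `(1,3)`-Wronskian
      have z1 := Multiset.count_eq_zero.2 (fun h : j ∈ E₁ => h₁₃ j h hj3)
      have z2 := Multiset.count_eq_zero.2 (fun h : j ∈ E₂ => h₂₃ j h hj3)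
      have hc : Multiset.count j (E₁ + E₂ + E₃) = Multiset.count j E₃ := by omega
      rw [hc]
      have h3 : q j ^ (Multiset.count j E₃ - 1) ∣
          (E₁.map q).prod * pderiv s (E₃.map q).prod - (E₃.map q).prod * pderiv s (E₁.map q).prod :=
        dvd_sub ((pow_pred_dvd_pderiv s (pow_count_dvd_prod q E₃ j)).mul_left _)
          (((pow_dvd_pow _ (Nat.sub_le _ 1)).trans (pow_count_dvd_prod q E₃ j)).mul_right _)
      have e2 : C α₂ * (E₂.map q).prod = -(C α₁ * (E₁.map q).prod) - C α₃ * (E₃.map q).prod := by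
        linear_combination hsum
      have e2' := congrArg (pderiv s) e2
      rw [pderiv_C_mul, map_sub, map_neg, pderiv_C_mul, pderiv_C_mul] at e2'
      have key : C α₂ * ((E₁.map q).prod * pderiv s (E₂.map q).prod -
            (E₂.map q).prod * pderiv s (E₁.map q).prod) =
          -(C α₃ * ((E₁.map q).prod * pderiv s (E₃.map q).prod -
            (E₃.map q).prod * pderiv s (E₁.map q).prod)) := by
        linear_combination (E₁.map q).prod * e2' - pderiv s (E₁.map q).prod * e2
      have hu : IsUnit (C α₂ : MvPolynomial σ K) := (isUnit_iff_ne_zero.2 hα₂).map C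
      rw [← hu.dvd_mul_left, key, dvd_neg]
      exact h3.mul_left _
  -- degrees: `deg D = Σ_j d (c_j − 1)`, `deg D + d·N = 3·d·n`, `deg D ≤ deg W < 2·d·n`
  have hD0 : (∏ j ∈ (E₁ + E₂ + E₃).toFinset, q j ^ (Multiset.count j (E₁ + E₂ + E₃) - 1)) ≠ 0 :=
    Finset.prod_ne_zero_iff.2 fun j hj => pow_ne_zero _ (hprime j (Multiset.mem_toFinset.1 hj)).ne_zero
  have hDhom : (∏ j ∈ (E₁ + E₂ + E₃).toFinset, q j ^ (Multiset.count j (E₁ + E₂ + E₃) - 1)).IsHomogeneous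
      (∑ j ∈ (E₁ + E₂ + E₃).toFinset, d * (Multiset.count j (E₁ + E₂ + E₃) - 1)) :=
    IsHomogeneous.prod (E₁ + E₂ + E₃).toFinset (fun j => q j ^ (Multiset.count j (E₁ + E₂ + E₃) - 1))
      (fun j => d * (Multiset.count j (E₁ + E₂ + E₃) - 1))
      fun j hj => (hhom j (Multiset.mem_toFinset.1 hj)).pow _
  have hdegD := totalDegree_le_of_dvd_of_isDomain hDW hW
  rw [hDhom.totalDegree hD0] at hdegD
  have hsumD : (∑ j ∈ (E₁ + E₂ + E₃).toFinset, d * (Multiset.count j (E₁ + E₂ + E₃) - 1)) +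
      d * (E₁ + E₂ + E₃).toFinset.card = d * n + d * n + d * n :=
    calc (∑ j ∈ (E₁ + E₂ + E₃).toFinset, d * (Multiset.count j (E₁ + E₂ + E₃) - 1)) +
          d * (E₁ + E₂ + E₃).toFinset.card
        = (∑ j ∈ (E₁ + E₂ + E₃).toFinset, d * (Multiset.count j (E₁ + E₂ + E₃) - 1)) +
            ∑ _j ∈ (E₁ + E₂ + E₃).toFinset, d := by
          rw [Finset.sum_const, smul_eq_mul]; ring
      _ = ∑ j ∈ (E₁ + E₂ + E₃).toFinset, (d * (Multiset.count j (E₁ + E₂ + E₃) - 1) + d) :=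
          Finset.sum_add_distrib.symm
      _ = ∑ j ∈ (E₁ + E₂ + E₃).toFinset, d * Multiset.count j (E₁ + E₂ + E₃) :=
          Finset.sum_congr rfl fun j hj => by
            have h1 : 1 ≤ Multiset.count j (E₁ + E₂ + E₃) :=
              Multiset.one_le_count_iff_mem.2 (Multiset.mem_toFinset.1 hj)
            calc d * (Multiset.count j (E₁ + E₂ + E₃) - 1) + d
                = d * (Multiset.count j (E₁ + E₂ + E₃) - 1 + 1) := by ring
              _ = d * Multiset.count j (E₁ + E₂ + E₃) := by rw [Nat.sub_add_cancel h1]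
      _ = d * ∑ j ∈ (E₁ + E₂ + E₃).toFinset, Multiset.count j (E₁ + E₂ + E₃) := by
          rw [Finset.mul_sum]
      _ = d * Multiset.card (E₁ + E₂ + E₃) := by rw [Multiset.toFinset_sum_count_eq]
      _ = d * n + d * n + d * n := by rw [Multiset.card_add, Multiset.card_add, c₁, c₂, c₃]; ring
  have hW2 : ((E₁.map q).prod * pderiv s (E₂.map q).prod -
      (E₂.map q).prod * pderiv s (E₁.map q).prod).totalDegree < d * n + d * n := by
    have t1 := totalDegree_mul_pderiv_lt s (E₁.map q).prod (E₂.map q).prod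
      (by rw [hdegE E₂ hS₂ c₂]; exact mul_pos hd hn)
    have t2 := totalDegree_mul_pderiv_lt s (E₂.map q).prod (E₁.map q).prod
      (by rw [hdegE E₁ hS₁ c₁]; exact mul_pos hd hn)
    rw [hdegE E₁ hS₁ c₁, hdegE E₂ hS₂ c₂] at t1 t2
    exact (totalDegree_sub _ _).trans_lt (max_lt t1 t2)
  omega

end Mason

end Summit.ValiantsHypothesis.ValiantsHypothesis.Theorems.DefinabilityGapMasonStothers
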